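import Mathlib.Algebra.Polynomial.Laurent
import Mathlib.RingTheory.PowerSeries.Basic
import Mathlib.Analysis.Normed.Ring.InfiniteSum
import Mathlib.Analysis.Normed.Field.Basic
import Mathlib.Analysis.Normed.Group.InfiniteSum
import HarnessLib

/-!
# Evaluating `q`-series with Laurent-polynomial coefficients in a complete normed field
# (the ring `ℤ[u,u⁻¹]⟦q⟧` of Silverman ATAEC V §3, proof of Thm. V.3.1 (c))

Topic `Literature/NumberTheory/EllipticCurves/TateCurve`, namespace
`Literature.NumberTheory.EllipticCurves.TateCurve` (abc-iut cell, TRANCHE-T1 P21; sub-lemma U-2a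
of the discharge plan of the named fact `uniformization`).

Silverman (PDF p. 397) proves the Tate equation `Y² + XY = X³ + a₄X + a₆` for the `p`-adic
series `X(u,q), Y(u,q)` by viewing both sides, on the annulus `|q| < |u| < |q|⁻¹`, as "power series
in `q` with coefficients that are rational functions of `u`", establishing the identity NUMERICALLY
over `ℂ` (Thm. V.1.1), deducing it FORMALLY in `ℚ(u)⟦q⟧`, and evaluating in the `p`-adic field.
This file provides the (denominator-free) formal ring we use for that transfer,
`PowerSeries (LaurentPolynomial ℤ)` = `ℤ[T;T⁻¹]⟦q⟧`, and its EVALUATION in an arbitrary complete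
normed field `𝕜` at a unit `u` and an element `q`:

* `evCoeff u : ℤ[T;T⁻¹] →+* 𝕜` (Mathlib `LaurentPolynomial.eval₂` at the unit `u`);
* `evTerm Φ u q d = evCoeff u (coeff d Φ) · q^d`, `EvSummable Φ u q` (absolute convergence),
  `ev Φ u q = Σ_d evTerm Φ u q d`;
* `ev` is additive and — on absolutely convergent series — multiplicative (`ev_mul`, Cauchy
  product, Mathlib `tsum_mul_tsum_eq_tsum_sum_antidiagonal_of_summable_norm`), with
  `EvSummable` closed under `+`, `−`, `*`, constants.

All statements hold verbatim for `𝕜 = ℂ` and for `p`-adic `𝕜`; this is what makes the transfer work.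

## References
* [SilvermanATAEC1994] J. H. Silverman, *Advanced Topics in the Arithmetic of Elliptic Curves*,
  GTM 151, Springer 1994, proof of Thm. V.3.1 (c) (PDF pp. 396–397).
-/

noncomputable section

open LaurentPolynomial PowerSeries Finset

namespace Literature.NumberTheory.EllipticCurves.TateCurve

/-- The formal coefficient ring `ℤ[u, u⁻¹]⟦q⟧` of the transfer argument (Silverman works in
`ℚ(u)⟦q⟧`; we clear the denominators `(1 − u)ᵏ`). [cite: SilvermanATAEC1994, Thm. V.3.1 (c) (proof, PDF p. 397)] -/
abbrev LaurentQSeries : Type := PowerSeries (LaurentPolynomial ℤ)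

variable {𝕜 : Type*} [NormedField 𝕜]

/-- Evaluation of a coefficient `c(u) ∈ ℤ[u,u⁻¹]` at a unit `u` of `𝕜`.
[cite: SilvermanATAEC1994, Thm. V.3.1 (c) (proof, PDF p. 397)] -/
def evCoeff (u : 𝕜ˣ) : LaurentPolynomial ℤ →+* 𝕜 :=
  LaurentPolynomial.eval₂ (Int.castRingHom 𝕜) u

/-- `evCoeff u (T n) = u ^ n`. [cite: SilvermanATAEC1994, Thm. V.3.1 (c) (proof, PDF p. 397)] -/
@[simp] theorem evCoeff_T (u : 𝕜ˣ) (n : ℤ) : evCoeff u (T n) = ((u ^ n : 𝕜ˣ) : 𝕜) := by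
  rw [evCoeff, eval₂_T]

/-- `evCoeff u (C r) = r`. [cite: SilvermanATAEC1994, Thm. V.3.1 (c) (proof, PDF p. 397)] -/
@[simp] theorem evCoeff_C (u : 𝕜ˣ) (r : ℤ) : evCoeff u (C r) = (r : 𝕜) := by
  rw [evCoeff, eval₂_C]; simp

/-- The `d`-th term `c_d(u) q^d` of the evaluation of `Φ = Σ c_d q^d`.
[cite: SilvermanATAEC1994, Thm. V.3.1 (c) (proof, PDF p. 397)] -/
def evTerm (Φ : LaurentQSeries) (u : 𝕜ˣ) (q : 𝕜) (d : ℕ) : 𝕜 :=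
  evCoeff u (coeff d Φ) * q ^ d

/-- Absolute convergence of the evaluation of `Φ` at `(u, q)`.
[cite: SilvermanATAEC1994, Thm. V.3.1 (c) (proof, PDF p. 397)] -/
def EvSummable (Φ : LaurentQSeries) (u : 𝕜ˣ) (q : 𝕜) : Prop :=
  Summable fun d ↦ ‖evTerm Φ u q d‖

/-- The evaluation `ev Φ u q = Σ_d c_d(u) q^d` (junk `0` if not summable).
[cite: SilvermanATAEC1994, Thm. V.3.1 (c) (proof, PDF p. 397)] -/
def ev (Φ : LaurentQSeries) (u : 𝕜ˣ) (q : 𝕜) : 𝕜 :=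
  ∑' d, evTerm Φ u q d

variable (u : 𝕜ˣ) (q : 𝕜)

/-- Terms are additive. [cite: SilvermanATAEC1994, Thm. V.3.1 (c) (proof, PDF p. 397)] -/
theorem evTerm_add (Φ Ψ : LaurentQSeries) (d : ℕ) :
    evTerm (Φ + Ψ) u q d = evTerm Φ u q d + evTerm Ψ u q d := by
  simp [evTerm, map_add, add_mul]

/-- Terms of a negation. [cite: SilvermanATAEC1994, Thm. V.3.1 (c) (proof, PDF p. 397)] -/
theorem evTerm_neg (Φ : LaurentQSeries) (d : ℕ) : evTerm (-Φ) u q d = -evTerm Φ u q d := by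
  simp [evTerm, map_neg]

/-- Terms of a product: the Cauchy product formula.
[cite: SilvermanATAEC1994, Thm. V.3.1 (c) (proof, PDF p. 397)] -/
theorem evTerm_mul (Φ Ψ : LaurentQSeries) (d : ℕ) :
    evTerm (Φ * Ψ) u q d = ∑ ij ∈ antidiagonal d, evTerm Φ u q ij.1 * evTerm Ψ u q ij.2 := by
  rw [evTerm, coeff_mul, map_sum, sum_mul]
  refine sum_congr rfl fun ij hij ↦ ?_
  rw [mem_antidiagonal] at hij
  rw [map_mul, evTerm, evTerm, ← hij, pow_add]
  ring

/-- Terms of a constant series `C c`. [cite: SilvermanATAEC1994, Thm. V.3.1 (c) (proof, PDF p. 397)] -/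
theorem evTerm_C (c : LaurentPolynomial ℤ) (d : ℕ) :
    evTerm (PowerSeries.C c) u q d = if d = 0 then evCoeff u c else 0 := by
  rw [evTerm, coeff_C]
  split_ifs with h
  · simp [h]
  · simp

/-- `EvSummable` is preserved by addition. [cite: SilvermanATAEC1994, Thm. V.3.1 (c) (proof, PDF p. 397)] -/
theorem EvSummable.add {Φ Ψ : LaurentQSeries} (hΦ : EvSummable Φ u q) (hΨ : EvSummable Ψ u q) :
    EvSummable (Φ + Ψ) u q := by
  refine Summable.of_nonneg_of_le (fun _ ↦ norm_nonneg _) (fun d ↦ ?_) (Summable.add hΦ hΨ)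
  rw [evTerm_add]
  exact norm_add_le _ _

/-- `EvSummable` is preserved by negation. [cite: SilvermanATAEC1994, Thm. V.3.1 (c) (proof, PDF p. 397)] -/
theorem EvSummable.neg {Φ : LaurentQSeries} (hΦ : EvSummable Φ u q) : EvSummable (-Φ) u q := by
  refine hΦ.congr fun d ↦ ?_
  rw [evTerm_neg, norm_neg]

/-- `EvSummable` is preserved by subtraction. [cite: SilvermanATAEC1994, Thm. V.3.1 (c) (proof, PDF p. 397)] -/
theorem EvSummable.sub {Φ Ψ : LaurentQSeries} (hΦ : EvSummable Φ u q) (hΨ : EvSummable Ψ u q) :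
    EvSummable (Φ - Ψ) u q := by
  rw [sub_eq_add_neg]; exact hΦ.add u q (hΨ.neg u q)

/-- `EvSummable` is preserved by products (Mertens/Cauchy).
[cite: SilvermanATAEC1994, Thm. V.3.1 (c) (proof, PDF p. 397)] -/
theorem EvSummable.mul [CompleteSpace 𝕜] {Φ Ψ : LaurentQSeries} (hΦ : EvSummable Φ u q)
    (hΨ : EvSummable Ψ u q) : EvSummable (Φ * Ψ) u q := by
  have h := summable_norm_sum_mul_antidiagonal_of_summable_norm hΦ hΨ
  refine h.congr fun d ↦ ?_
  rw [evTerm_mul]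

/-- Constants are `EvSummable`. [cite: SilvermanATAEC1994, Thm. V.3.1 (c) (proof, PDF p. 397)] -/
theorem EvSummable.C (c : LaurentPolynomial ℤ) : EvSummable (PowerSeries.C c) u q := by
  refine summable_of_ne_finset_zero (s := {0}) fun d hd ↦ ?_
  rw [Finset.mem_singleton] at hd
  rw [evTerm_C, if_neg hd, norm_zero]

/-- Powers are `EvSummable`. [cite: SilvermanATAEC1994, Thm. V.3.1 (c) (proof, PDF p. 397)] -/
theorem EvSummable.pow [CompleteSpace 𝕜] {Φ : LaurentQSeries} (hΦ : EvSummable Φ u q) :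
    ∀ n : ℕ, EvSummable (Φ ^ n) u q
  | 0 => by rw [pow_zero, ← map_one PowerSeries.C]; exact EvSummable.C u q 1
  | n + 1 => by rw [pow_succ]; exact (EvSummable.pow hΦ n).mul u q hΦ

/-- `ev` is additive on summable series. [cite: SilvermanATAEC1994, Thm. V.3.1 (c) (proof, PDF p. 397)] -/
theorem ev_add [CompleteSpace 𝕜] {Φ Ψ : LaurentQSeries} (hΦ : EvSummable Φ u q)
    (hΨ : EvSummable Ψ u q) : ev (Φ + Ψ) u q = ev Φ u q + ev Ψ u q := by
  rw [ev, ev, ev, ← (Summable.of_norm hΦ).tsum_add (Summable.of_norm hΨ)]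
  exact tsum_congr fun d ↦ evTerm_add u q Φ Ψ d

/-- `ev` of a negation. [cite: SilvermanATAEC1994, Thm. V.3.1 (c) (proof, PDF p. 397)] -/
theorem ev_neg (Φ : LaurentQSeries) : ev (-Φ) u q = -ev Φ u q := by
  rw [ev, ev, ← tsum_neg]
  exact tsum_congr fun d ↦ evTerm_neg u q Φ d

/-- `ev` of a difference. [cite: SilvermanATAEC1994, Thm. V.3.1 (c) (proof, PDF p. 397)] -/
theorem ev_sub [CompleteSpace 𝕜] {Φ Ψ : LaurentQSeries} (hΦ : EvSummable Φ u q)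
    (hΨ : EvSummable Ψ u q) : ev (Φ - Ψ) u q = ev Φ u q - ev Ψ u q := by
  rw [sub_eq_add_neg, ev_add u q hΦ (hΨ.neg u q), ev_neg, ← sub_eq_add_neg]

/-- **`ev` is multiplicative on absolutely convergent series** (Cauchy product).
[cite: SilvermanATAEC1994, Thm. V.3.1 (c) (proof, PDF p. 397)] -/
theorem ev_mul [CompleteSpace 𝕜] {Φ Ψ : LaurentQSeries} (hΦ : EvSummable Φ u q)
    (hΨ : EvSummable Ψ u q) : ev (Φ * Ψ) u q = ev Φ u q * ev Ψ u q := by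
  rw [ev, ev, ev, tsum_mul_tsum_eq_tsum_sum_antidiagonal_of_summable_norm hΦ hΨ]
  exact tsum_congr fun d ↦ evTerm_mul u q Φ Ψ d

/-- `ev` of a power. [cite: SilvermanATAEC1994, Thm. V.3.1 (c) (proof, PDF p. 397)] -/
theorem ev_pow [CompleteSpace 𝕜] {Φ : LaurentQSeries} (hΦ : EvSummable Φ u q) :
    ∀ n : ℕ, ev (Φ ^ n) u q = ev Φ u q ^ n
  | 0 => by
    rw [pow_zero, pow_zero, ev, ← map_one PowerSeries.C, tsum_eq_single 0 fun d hd ↦ by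
      rw [evTerm_C, if_neg hd]]
    rw [evTerm_C, if_pos rfl, map_one]
  | n + 1 => by rw [pow_succ, pow_succ, ev_mul u q (hΦ.pow u q n) hΦ, ev_pow hΦ n]

/-- `ev` of a constant. [cite: SilvermanATAEC1994, Thm. V.3.1 (c) (proof, PDF p. 397)] -/
theorem ev_C (c : LaurentPolynomial ℤ) : ev (PowerSeries.C c) u q = evCoeff u c := by
  rw [ev, tsum_eq_single 0 fun d hd ↦ by rw [evTerm_C, if_neg hd], evTerm_C, if_pos rfl]

/-- `ev (C c * Φ) = c(u) · ev Φ`. [cite: SilvermanATAEC1994, Thm. V.3.1 (c) (proof, PDF p. 397)] -/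
theorem ev_C_mul (c : LaurentPolynomial ℤ) (Φ : LaurentQSeries) :
    ev (PowerSeries.C c * Φ) u q = evCoeff u c * ev Φ u q := by
  rw [ev, ev, ← tsum_mul_left]
  refine tsum_congr fun d ↦ ?_
  rw [evTerm, evTerm, coeff_C_mul, map_mul, mul_assoc]

/-- `EvSummable (C c * Φ)` from `EvSummable Φ`. [cite: SilvermanATAEC1994, Thm. V.3.1 (c) (proof, PDF p. 397)] -/
theorem EvSummable.C_mul {Φ : LaurentQSeries} (hΦ : EvSummable Φ u q) (c : LaurentPolynomial ℤ) :
    EvSummable (PowerSeries.C c * Φ) u q := by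
  have h := Summable.mul_left ‖evCoeff u c‖ hΦ
  refine Summable.of_nonneg_of_le (fun _ ↦ norm_nonneg _) (fun d ↦ ?_) h
  rw [evTerm, coeff_C_mul, map_mul, mul_assoc, norm_mul]
  rfl

/-- The evaluation as a `HasSum` statement. [cite: SilvermanATAEC1994, Thm. V.3.1 (c) (proof, PDF p. 397)] -/
theorem hasSum_evTerm [CompleteSpace 𝕜] {Φ : LaurentQSeries} (hΦ : EvSummable Φ u q) :
    HasSum (evTerm Φ u q) (ev Φ u q) :=
  (Summable.of_norm hΦ).hasSum

/-- If the terms of `Φ` at `(u,q)` agree with a summable family with sum `s`, then `ev Φ u q = s`.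
[cite: SilvermanATAEC1994, Thm. V.3.1 (c) (proof, PDF p. 397)] -/
theorem ev_eq_of_hasSum {Φ : LaurentQSeries} {s : 𝕜} (h : HasSum (evTerm Φ u q) s) :
    ev Φ u q = s :=
  h.tsum_eq

end Literature.NumberTheory.EllipticCurves.TateCurve

end
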